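import Literature.MathematicalPhysics.QuantumFieldTheory.Balaban1983to89.B9Thm314WholePair

/-!
# `Balaban1983to89.B9Thm314WholePairWalks` — [B9] Theorem 3.14 (pp. 426–427): THE WALK SETS OF THE DIFFERENCE, CONSTRUCTED FROM THE
# WALK SETS OF THE TWO EXPANSIONS (rows 22–23 of the N06 certificate: the pair-level reading data `W hW hcnt` become per-sequence data)

T. Bałaban, *Propagators for lattice gauge theories in a background field*, Commun. Math. Phys. **99** (1985) 389–434
[`Balaban1985BackgroundPropagators`, "B9"].

statement-level skeleton of published theorems with citation tags; proofs where landed; nothing here is a claim about the Yang–Mills mass gap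

THE PRINTED LOCUS (verbatim, p. 427, proof of Theorem 3.14): *"We take random walk expansions for both operators. Terms of these
expansions are the same for walks which have all localizations contained in Ω, or Ω^{(k)}, thus in the difference they are cancelled
and we have walks with at least one localization intersecting Ωᶜ. For such ω we have d(ω, y, y′) ≥ d(y, y′, Ω). This remark, the
estimates (3.108) and the corresponding estimates for other norms, give the inequalities of the above theorem."*; p. 416 (3.107):
*"the sum is over walks ω = ((0, X₀), (α₁, X₁), …, (αₙ, Xₙ))"*.

THE POINT.  Rows 22–23 of the N06 certificate (`t314`, `t314loc`) are supplied by `B9Thm314WholePair.thm314_pair_of_pair_reading`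
(seat n06-m g2; consumed by n06-d g3's knit `…N06AtOpsYOfLettersAllPinsB`, p477264) from two Theorem-3.10 all-norms leaves, the
geometry, the M-uniform diameter bound `hr`, and a READING of the summation for the PAIR expansion `pairExpansion E₁ E₂ T₁ T₂` (walks =
the walks of either sequence touching Ωᶜ): finite walk sets `W n y y′` of the pair (`WalkSetsSpec`), their uniform weight summability
(`WalkWeightsSummable`) and the domination of the difference family by the partial sums (`DominatedBySums`).  In print the walk sets
are those of the two expansions (3.107) — one family per operator; THIS FILE constructs the pair's walk sets from them:
* §1 `pairWalkSets W₁ W₂ T₁ T₂ n y y′ := ((W₁ n y y′).subtype T₁).disjSum ((W₂ n y y′).subtype T₂)` — the touching walks of E₁ from y to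
  y′ of length n together with those of E₂; membership (`mem_pairWalkSets_inl ∕ _inr`), the splitting of sums over it into the two
  FILTERED per-sequence sums (`sum_pairWalkSets`, `sum_pairWalkSets_pairTermK` — the shape in which an operator identity «G(Ω) − G(Ω′) =
  Σ_{touching ω} ± ω-terms» delivers the partial sums of `DominatedBySums`), the card bound, and `walkSetsSpec_pair`.
* §2 the family level: `walkSetsSpec_mono` ∕ `walkWeightsSummable_mono` (sub-walk-sets inherit both laws) and ★ `walkWeightsSummable_pair`
  — the pair's weights are uniformly summable when each sequence's are (N₀ := N₁ + N₂, D₀ := max D₁ D₂, δ′ := min δ′₁ δ′₂; needs d ≥ 0).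
* §3 the row faces ★ `thm314_pair_of_pair_walks` (rows 22 ∧ 23), `thm314LocalPrinted_of_pair_walks`, `thm314Printed_of_pair_walks`:
  `thm314_pair_of_pair_reading` with `W := pairWalkSets …`, `hW := walkSetsSpec_pair …`, `hcnt := walkWeightsSummable_pair …` — displayed
  per sequence: `Wᵢ : ℕ → Site → Site → Finset (Eᵢ i).Walk`, `WalkSetsSpec (Eᵢ i) (Wᵢ i)`, `WalkWeightsSummable geo bg Eᵢ Wᵢ` (i = 1, 2 —
  the shape of row 18's walk data; at a `B9Thm310Whole.W310OfOps`-type pin, that pin's walk sets), and `hdom` at the constructed pair sets.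

HONEST SCOPE.  Count-neutral kernel bookkeeping (finite sums over disjoint unions, one geometric-weight estimate); the cancellation
identity itself stays the displayed reading `hdom` (GAPS G-B9-08), the two Theorem-3.10 letters, the geometry laws and `hr` (typed-leaf flag
T314 (ii) STANDS) stay displayed exactly as in `B9Thm314WholePair`; nothing of print is asserted; NOT a node discharge, NOT summit
progress; one finite lattice paper; nothing continuum, nothing about the mass gap.  Cell `pub-ymgap` (D-0062), node N06 [B9], N06-ASSIGNMENT
v1 rows 22–23 (successor file of bundle F8), seat `pub-ymgap-dag-n06-m` (g3), 2026-08-27.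
-/

namespace Literature.MathematicalPhysics.QuantumFieldTheory.Balaban1983to89.B9Thm314WholePairWalks

open B9 B9Thm314 B9Thm314Whole B9Thm314WholeSummation B9Thm314WholePair B9SectCWalkTermsAllNorms B9FromB6ModelSignsOn
open Finset

/-! ## §1 The pair's walk sets from the two sequences' walk sets -/

section Pair

variable {g : Geometry} {B : Backgrounds} {E₁ E₂ : RWExpansion g B}

open Classical in
/-- **THE WALK SETS OF THE DIFFERENCE** (p. 427): the walks of length n from y to y′ of the pair expansion `pairExpansion E₁ E₂ T₁ T₂` are
the walks of `W₁ n y y′` satisfying `T₁` (E₁'s walks touching Ωᶜ) together with the walks of `W₂ n y y′` satisfying `T₂` — a disjoint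
union of the two restricted finite sets. [cite: Balaban1985BackgroundPropagators, Thm 3.14 proof p.427 + (3.107) p.415] -/
noncomputable def pairWalkSets (W₁ : ℕ → g.Site → g.Site → Finset E₁.Walk) (W₂ : ℕ → g.Site → g.Site → Finset E₂.Walk)
    (T₁ : E₁.Walk → Prop) (T₂ : E₂.Walk → Prop) (n : ℕ) (y y' : g.Site) : Finset (pairExpansion E₁ E₂ T₁ T₂).Walk :=
  ((W₁ n y y').subtype T₁).disjSum ((W₂ n y y').subtype T₂)

variable (W₁ : ℕ → g.Site → g.Site → Finset E₁.Walk) (W₂ : ℕ → g.Site → g.Site → Finset E₂.Walk)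
  (T₁ : E₁.Walk → Prop) (T₂ : E₂.Walk → Prop)

/-- a touching walk of the first sequence lies in the pair's walk set iff it lies in the first sequence's.
[cite: Balaban1985BackgroundPropagators, Thm 3.14 proof p.427 (bookkeeping)] -/
theorem mem_pairWalkSets_inl (n : ℕ) (y y' : g.Site) (ω : {ω : E₁.Walk // T₁ ω}) :
    (Sum.inl ω : (pairExpansion E₁ E₂ T₁ T₂).Walk) ∈ pairWalkSets W₁ W₂ T₁ T₂ n y y' ↔ ω.1 ∈ W₁ n y y' := by
  classical
  show (Sum.inl ω : {ω : E₁.Walk // T₁ ω} ⊕ {ω : E₂.Walk // T₂ ω}) ∈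
      ((W₁ n y y').subtype T₁).disjSum ((W₂ n y y').subtype T₂) ↔ _
  rw [Finset.inl_mem_disjSum, Finset.mem_subtype]

/-- … and likewise for the second sequence. [cite: Balaban1985BackgroundPropagators, Thm 3.14 proof p.427 (bookkeeping)] -/
theorem mem_pairWalkSets_inr (n : ℕ) (y y' : g.Site) (ω : {ω : E₂.Walk // T₂ ω}) :
    (Sum.inr ω : (pairExpansion E₁ E₂ T₁ T₂).Walk) ∈ pairWalkSets W₁ W₂ T₁ T₂ n y y' ↔ ω.1 ∈ W₂ n y y' := by
  classical
  show (Sum.inr ω : {ω : E₁.Walk // T₁ ω} ⊕ {ω : E₂.Walk // T₂ ω}) ∈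
      ((W₁ n y y').subtype T₁).disjSum ((W₂ n y y').subtype T₂) ↔ _
  rw [Finset.inr_mem_disjSum, Finset.mem_subtype]

open Classical in
/-- **A SUM OVER THE PAIR'S WALK SET SPLITS** into the two per-sequence sums over the TOUCHING walks (the filtered sets) — the shape in
which «G(Ω) − G(Ω′) = Σ_{ω touching Ωᶜ} (ω-term of the first expansion) − Σ_{ω touching Ωᶜ} (ω-term of the second)» delivers partial sums.
[cite: Balaban1985BackgroundPropagators, Thm 3.14 proof p.427 (bookkeeping)] -/
theorem sum_pairWalkSets (q₁ : E₁.Walk → ℝ) (q₂ : E₂.Walk → ℝ) (n : ℕ) (y y' : g.Site) :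
    ∑ ω ∈ pairWalkSets W₁ W₂ T₁ T₂ n y y', Sum.elim (fun ω => q₁ ω.1) (fun ω => q₂ ω.1) ω =
      ∑ ω ∈ (W₁ n y y').filter T₁, q₁ ω + ∑ ω ∈ (W₂ n y y').filter T₂, q₂ ω := by
  show ∑ ω ∈ ((W₁ n y y').subtype T₁).disjSum ((W₂ n y y').subtype T₂),
      Sum.elim (fun ω : {ω : E₁.Walk // T₁ ω} => q₁ ω.1) (fun ω : {ω : E₂.Walk // T₂ ω} => q₂ ω.1) ω = _
  rw [Finset.sum_disjSum]
  simp only [Sum.elim_inl, Sum.elim_inr]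
  rw [Finset.sum_subtype_eq_sum_filter (f := q₁), Finset.sum_subtype_eq_sum_filter (f := q₂)]

open Classical in
/-- **THE QUANTITIES OF THE INHERITED WALK TERMS SUM ACCORDINGLY**: for any functional `Q` of a kernel family, the sum of `Q` of the pair's
walk terms (`pairTermK`) over the pair's walk set = the filtered sum of `Q (termK₁ ω)` plus the filtered sum of `Q (termK₂ ω)` — the partial
sums appearing in `B9Thm314WholeSummation.DominatedBySums` for the pair. [cite: Balaban1985BackgroundPropagators, Thm 3.14 proof p.427 + (3.108) p.416 (bookkeeping)] -/
theorem sum_pairWalkSets_pairTermK (termK₁ : E₁.Walk → KernelFamily g B) (termK₂ : E₂.Walk → KernelFamily g B)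
    (Q : KernelFamily g B → ℝ) (n : ℕ) (y y' : g.Site) :
    ∑ ω ∈ pairWalkSets W₁ W₂ T₁ T₂ n y y', Q (pairTermK E₁ E₂ T₁ T₂ termK₁ termK₂ ω) =
      ∑ ω ∈ (W₁ n y y').filter T₁, Q (termK₁ ω) + ∑ ω ∈ (W₂ n y y').filter T₂, Q (termK₂ ω) := by
  show ∑ ω ∈ ((W₁ n y y').subtype T₁).disjSum ((W₂ n y y').subtype T₂),
      Q (Sum.elim (fun ω : {ω : E₁.Walk // T₁ ω} => termK₁ ω.1) (fun ω : {ω : E₂.Walk // T₂ ω} => termK₂ ω.1) ω) = _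
  rw [Finset.sum_disjSum]
  simp only [Sum.elim_inl, Sum.elim_inr]
  rw [Finset.sum_subtype_eq_sum_filter (f := fun ω => Q (termK₁ ω)), Finset.sum_subtype_eq_sum_filter (f := fun ω => Q (termK₂ ω))]

/-- the pair's walk set has at most `#W₁ + #W₂` elements (for the walk-count route `B9Thm314WholeSummation.walkWeightsSummable_of_card`).
[cite: Balaban1985BackgroundPropagators, Cor. 3.8 (3.91) p.410 (bookkeeping)] -/
theorem card_pairWalkSets_le (n : ℕ) (y y' : g.Site) :
    (pairWalkSets W₁ W₂ T₁ T₂ n y y').card ≤ (W₁ n y y').card + (W₂ n y y').card := by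
  classical
  show (((W₁ n y y').subtype T₁).disjSum ((W₂ n y y').subtype T₂)).card ≤ _
  rw [Finset.card_disjSum, Finset.card_subtype, Finset.card_subtype]
  exact Nat.add_le_add (Finset.card_filter_le _ _) (Finset.card_filter_le _ _)

variable {W₁ W₂}

/-- **THE THREE MEMBERSHIP LAWS ARE INHERITED**: if `W₁`, `W₂` consist of walks of length n from y to y′ (`WalkSetsSpec`), so does the pair's
walk set (lengths and end-points of the pair expansion are the sequences', `B9Thm314WholePair.pairExpansion`).
[cite: Balaban1985BackgroundPropagators, Thm 3.7 (3.90) p.409 + (3.107) p.415 (bookkeeping)] -/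
theorem walkSetsSpec_pair (hW₁ : WalkSetsSpec E₁ W₁) (hW₂ : WalkSetsSpec E₂ W₂) :
    WalkSetsSpec (pairExpansion E₁ E₂ T₁ T₂) (pairWalkSets W₁ W₂ T₁ T₂) where
  first := by
    rintro n y y' (ω | ω) hω
    · exact hW₁.first n y y' ω.1 ((mem_pairWalkSets_inl W₁ W₂ T₁ T₂ n y y' ω).1 hω)
    · exact hW₂.first n y y' ω.1 ((mem_pairWalkSets_inr W₁ W₂ T₁ T₂ n y y' ω).1 hω)
  last := by
    rintro n y y' (ω | ω) hω
    · exact hW₁.last n y y' ω.1 ((mem_pairWalkSets_inl W₁ W₂ T₁ T₂ n y y' ω).1 hω)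
    · exact hW₂.last n y y' ω.1 ((mem_pairWalkSets_inr W₁ W₂ T₁ T₂ n y y' ω).1 hω)
  wlen := by
    rintro n y y' (ω | ω) hω
    · exact hW₁.wlen n y y' ω.1 ((mem_pairWalkSets_inl W₁ W₂ T₁ T₂ n y y' ω).1 hω)
    · exact hW₂.wlen n y y' ω.1 ((mem_pairWalkSets_inr W₁ W₂ T₁ T₂ n y y' ω).1 hω)

end Pair

/-! ## §2 The family level: sub-walk-sets, and the pair's weights are uniformly summable -/

section Family

variable {I : Type} {geo : I → Geometry} {bg : I → Backgrounds} {E E₁ E₂ : ∀ i, RWExpansion (geo i) (bg i)}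

/-- sub-walk-sets inherit the membership laws. [cite: Balaban1985BackgroundPropagators, Thm 3.7 (3.90) p.409 (bookkeeping)] -/
theorem walkSetsSpec_mono {g : Geometry} {B : Backgrounds} {E₀ : RWExpansion g B} {W W' : ℕ → g.Site → g.Site → Finset E₀.Walk}
    (hsub : ∀ n y y', W' n y y' ⊆ W n y y') (hW : WalkSetsSpec E₀ W) : WalkSetsSpec E₀ W' :=
  ⟨fun n y y' ω hω => hW.first n y y' ω (hsub n y y' hω), fun n y y' ω hω => hW.last n y y' ω (hsub n y y' hω),
    fun n y y' ω hω => hW.wlen n y y' ω (hsub n y y' hω)⟩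

/-- sub-walk-sets inherit the uniform weight summability (the weights are nonnegative). [cite: Balaban1985BackgroundPropagators, Cor. 3.8 (3.91)–(3.94) p.410 (bookkeeping)] -/
theorem walkWeightsSummable_mono {W W' : ∀ i, ℕ → (geo i).Site → (geo i).Site → Finset (E i).Walk}
    (hsub : ∀ i n y y', W' i n y y' ⊆ W i n y y') (h : WalkWeightsSummable geo bg E W) : WalkWeightsSummable geo bg E W' := by
  intro δ hδ
  obtain ⟨N₀, D₀, δ', hN₀, hD₀, hδ', H⟩ := h δ hδ
  exact ⟨N₀, D₀, δ', hN₀, hD₀, hδ', fun i n y y' =>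
    (Finset.sum_le_sum_of_subset_of_nonneg (hsub i n y y') fun _ _ _ => Real.exp_nonneg _).trans (H i n y y')⟩

/-- one sequence's bound N·Dⁿ·e^{−δ′d} is below the pair's bound with D ≤ D₀, δ₀ ≤ δ′, for d ≥ 0. [cite: Balaban1985BackgroundPropagators, Cor. 3.8 (3.91) p.410 (bookkeeping)] -/
private theorem bound_mono {N D D₀ δ' δ₀ dd : ℝ} (hN : 0 ≤ N) (hD : 0 ≤ D) (hDD : D ≤ D₀) (hδ : δ₀ ≤ δ') (hd : 0 ≤ dd) (n : ℕ) :
    N * D ^ n * Real.exp (-(δ' * dd)) ≤ N * D₀ ^ n * Real.exp (-(δ₀ * dd)) :=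
  mul_le_mul (mul_le_mul_of_nonneg_left (pow_le_pow_left₀ hD hDD n) hN)
    (Real.exp_le_exp.2 (neg_le_neg (mul_le_mul_of_nonneg_right hδ hd))) (Real.exp_nonneg _)
    (mul_nonneg hN (pow_nonneg (hD.trans hDD) n))

open Classical in
/-- ★ **THE PAIR'S WEIGHTS ARE UNIFORMLY SUMMABLE WHEN EACH SEQUENCE'S ARE** (p. 410: the factor O(M^{−1/2}) controls the sum over walks —
for each operator's expansion separately; the difference inherits it): given `WalkWeightsSummable` for `W₁` (constants N₁, D₁, δ′₁ at the rate δ)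
and for `W₂` (N₂, D₂, δ′₂), the pair's walk sets `pairWalkSets (W₁ i) (W₂ i) (T₁ i) (T₂ i)` satisfy it with N₀ := N₁ + N₂, D₀ := max D₁ D₂,
δ′ := min δ′₁ δ′₂ (the touching restriction only drops nonnegative terms; the lattice distance is nonnegative, `hd`).
[cite: Balaban1985BackgroundPropagators, Cor. 3.8 (3.91)–(3.94) p.410 + Thm 3.14 proof p.427] -/
theorem walkWeightsSummable_pair (W₁ : ∀ i, ℕ → (geo i).Site → (geo i).Site → Finset (E₁ i).Walk)
    (W₂ : ∀ i, ℕ → (geo i).Site → (geo i).Site → Finset (E₂ i).Walk)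
    (T₁ : ∀ i, (E₁ i).Walk → Prop) (T₂ : ∀ i, (E₂ i).Walk → Prop)
    (hd : ∀ (i : I) (y y' : (geo i).Site), 0 ≤ (geo i).dist y y')
    (h₁ : WalkWeightsSummable geo bg E₁ W₁) (h₂ : WalkWeightsSummable geo bg E₂ W₂) :
    WalkWeightsSummable geo bg (fun i => pairExpansion (E₁ i) (E₂ i) (T₁ i) (T₂ i))
      (fun i => pairWalkSets (W₁ i) (W₂ i) (T₁ i) (T₂ i)) := by
  intro δ hδ
  obtain ⟨N₁, D₁, δ₁, hN₁, hD₁, hδ₁, H₁⟩ := h₁ δ hδ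
  obtain ⟨N₂, D₂, δ₂, hN₂, hD₂, hδ₂, H₂⟩ := h₂ δ hδ
  refine ⟨N₁ + N₂, max D₁ D₂, min δ₁ δ₂, add_pos hN₁ hN₂, lt_max_of_lt_left hD₁, lt_min hδ₁ hδ₂, fun i n y y' => ?_⟩
  have hsplit : ∑ ω ∈ pairWalkSets (W₁ i) (W₂ i) (T₁ i) (T₂ i) n y y',
      Real.exp (-(δ / 2 * (pairExpansion (E₁ i) (E₂ i) (T₁ i) (T₂ i)).wdist ω y y')) =
      ∑ ω ∈ (W₁ i n y y').filter (T₁ i), Real.exp (-(δ / 2 * (E₁ i).wdist ω y y')) +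
        ∑ ω ∈ (W₂ i n y y').filter (T₂ i), Real.exp (-(δ / 2 * (E₂ i).wdist ω y y')) := by
    rw [← sum_pairWalkSets (W₁ i) (W₂ i) (T₁ i) (T₂ i)]
    refine Finset.sum_congr rfl ?_
    rintro (ω | ω) -
    · rfl
    · rfl
  rw [hsplit]
  have hb₁ : ∑ ω ∈ (W₁ i n y y').filter (T₁ i), Real.exp (-(δ / 2 * (E₁ i).wdist ω y y')) ≤
      N₁ * max D₁ D₂ ^ n * Real.exp (-(min δ₁ δ₂ * (geo i).dist y y')) :=
    ((Finset.sum_le_sum_of_subset_of_nonneg (Finset.filter_subset _ _) fun _ _ _ => Real.exp_nonneg _).trans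
      (H₁ i n y y')).trans (bound_mono hN₁.le hD₁.le (le_max_left _ _) (min_le_left _ _) (hd i y y') n)
  have hb₂ : ∑ ω ∈ (W₂ i n y y').filter (T₂ i), Real.exp (-(δ / 2 * (E₂ i).wdist ω y y')) ≤
      N₂ * max D₁ D₂ ^ n * Real.exp (-(min δ₁ δ₂ * (geo i).dist y y')) :=
    ((Finset.sum_le_sum_of_subset_of_nonneg (Finset.filter_subset _ _) fun _ _ _ => Real.exp_nonneg _).trans
      (H₂ i n y y')).trans (bound_mono hN₂.le hD₂.le (le_max_right _ _) (min_le_right _ _) (hd i y y') n)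
  calc _ ≤ N₁ * max D₁ D₂ ^ n * Real.exp (-(min δ₁ δ₂ * (geo i).dist y y')) +
        N₂ * max D₁ D₂ ^ n * Real.exp (-(min δ₁ δ₂ * (geo i).dist y y')) := add_le_add hb₁ hb₂
    _ = (N₁ + N₂) * max D₁ D₂ ^ n * Real.exp (-(min δ₁ δ₂ * (geo i).dist y y')) := by ring

end Family

/-! ## §3 Rows 23 and 22 over the pair, walk sets per sequence -/

section Rows

variable {I : Type} {c35 : ℝ} {geo : I → Geometry} {bg : I → Backgrounds} {Kdiff : ∀ i, KernelFamily (geo i) (bg i)}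
  {OmK : ∀ i, (geo i).Site → Prop} {dOmega : ∀ i, (geo i).Site → (geo i).Site → ℝ}
  {E₁ E₂ : ∀ i, RWExpansion (geo i) (bg i)}
  {termK₁ : ∀ i, (E₁ i).Walk → KernelFamily (geo i) (bg i)} {termK₂ : ∀ i, (E₂ i).Walk → KernelFamily (geo i) (bg i)}
  {Ps : ∀ i, (geo i).Loc → Prop}

open Classical in
/-- ★ **ROWS 22 AND 23 OVER THE PAIR, WALK SETS PER SEQUENCE**: `B9Thm314WholePair.thm314_pair_of_pair_reading` with the pair's walk sets
CONSTRUCTED (`pairWalkSets`), their membership laws and uniform weight summability DERIVED from the two sequences' (`walkSetsSpec_pair`,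
`walkWeightsSummable_pair`; d ≥ 0 from the model signs).  Displayed: the two Theorem-3.10 all-norms leaves `h₁`, `h₂`; the geometry (`D₁`, `X₂`,
`Meets₂`, laws); the M-uniform diameter bound `hr` (flag T314 (ii) STANDS); the model signs, d(·,·,Ω) ≥ 0; PER SEQUENCE the finite walk sets `W₁`,
`W₂` with `WalkSetsSpec` and `WalkWeightsSummable` (the shape of row 18's walk data); and the domination reading `hdom` at the constructed pair
sets (the place of the cancellation identity, GAPS G-B9-08; its partial sums split per sequence by `sum_pairWalkSets_pairTermK`).  Conclusion:
`B9.Thm314Printed` (row 22) ∧ `B9Thm314.Thm314LocalPrinted` (row 23).  Nothing of print asserted; NOT a node discharge.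
[cite: Balaban1985BackgroundPropagators, Thm 3.14 (3.154) pp.426–427] -/
theorem thm314_pair_of_pair_walks (D₁ : ∀ i, LocData (geo i) (bg i) (E₁ i))
    (X₂ : ∀ i, (E₂ i).Walk → ℕ → (geo i).Site → Prop) (Meets₂ : ∀ i, (E₂ i).Walk → ℕ → Prop)
    (L₁ : ∀ i, (D₁ i).Laws (dOmega i)) (L₂ : ∀ i, (locData₂ (D₁ i) (X₂ i) (Meets₂ i)).Laws (dOmega i)) (r₀ : ℝ)
    (hr : ∀ i, (D₁ i).diam ≤ r₀) (S : ∀ i, ModelSignsOn (geo i) (Ps i)) (hdΩ : ∀ (i : I) (y y' : (geo i).Site), 0 ≤ dOmega i y y')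
    (h₁ : Thm310AllNormsPrinted c35 geo bg E₁ termK₁) (h₂ : Thm310AllNormsPrinted c35 geo bg E₂ termK₂)
    (W₁ : ∀ i, ℕ → (geo i).Site → (geo i).Site → Finset (E₁ i).Walk)
    (W₂ : ∀ i, ℕ → (geo i).Site → (geo i).Site → Finset (E₂ i).Walk)
    (hW₁ : ∀ i, WalkSetsSpec (E₁ i) (W₁ i)) (hW₂ : ∀ i, WalkSetsSpec (E₂ i) (W₂ i))
    (hcnt₁ : WalkWeightsSummable geo bg E₁ W₁) (hcnt₂ : WalkWeightsSummable geo bg E₂ W₂)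
    (hdom : ∀ (i : I) (U : (bg i).Cfg), (E₁ i).Converges U ∧ (E₂ i).Converges U →
      DominatedBySums (pairExpansion (E₁ i) (E₂ i) (D₁ i).Touches (locData₂ (D₁ i) (X₂ i) (Meets₂ i)).Touches)
        (pairTermK (E₁ i) (E₂ i) _ _ (termK₁ i) (termK₂ i)) (Kdiff i)
        (pairWalkSets (W₁ i) (W₂ i) (D₁ i).Touches (locData₂ (D₁ i) (X₂ i) (Meets₂ i)).Touches) U) :
    Thm314Printed c35 geo bg Kdiff dOmega ∧ Thm314LocalPrinted c35 geo bg Kdiff OmK dOmega :=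
  thm314_pair_of_pair_reading D₁ X₂ Meets₂ L₁ L₂ r₀ hr S hdΩ h₁ h₂
    (fun i => pairWalkSets (W₁ i) (W₂ i) (D₁ i).Touches (locData₂ (D₁ i) (X₂ i) (Meets₂ i)).Touches)
    (fun i => walkSetsSpec_pair _ _ (hW₁ i) (hW₂ i))
    (walkWeightsSummable_pair W₁ W₂ _ _ (fun i => (S i).dist_nonneg) hcnt₁ hcnt₂) hdom

open Classical in
/-- ★ **ROW 23** (`B9Thm314.Thm314LocalPrinted`) over the pair, walk sets per sequence. [cite: Balaban1985BackgroundPropagators, Thm 3.14 (3.154) pp.426–427] -/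
theorem thm314LocalPrinted_of_pair_walks (D₁ : ∀ i, LocData (geo i) (bg i) (E₁ i))
    (X₂ : ∀ i, (E₂ i).Walk → ℕ → (geo i).Site → Prop) (Meets₂ : ∀ i, (E₂ i).Walk → ℕ → Prop)
    (L₁ : ∀ i, (D₁ i).Laws (dOmega i)) (L₂ : ∀ i, (locData₂ (D₁ i) (X₂ i) (Meets₂ i)).Laws (dOmega i)) (r₀ : ℝ)
    (hr : ∀ i, (D₁ i).diam ≤ r₀) (S : ∀ i, ModelSignsOn (geo i) (Ps i)) (hdΩ : ∀ (i : I) (y y' : (geo i).Site), 0 ≤ dOmega i y y')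
    (h₁ : Thm310AllNormsPrinted c35 geo bg E₁ termK₁) (h₂ : Thm310AllNormsPrinted c35 geo bg E₂ termK₂)
    (W₁ : ∀ i, ℕ → (geo i).Site → (geo i).Site → Finset (E₁ i).Walk)
    (W₂ : ∀ i, ℕ → (geo i).Site → (geo i).Site → Finset (E₂ i).Walk)
    (hW₁ : ∀ i, WalkSetsSpec (E₁ i) (W₁ i)) (hW₂ : ∀ i, WalkSetsSpec (E₂ i) (W₂ i))
    (hcnt₁ : WalkWeightsSummable geo bg E₁ W₁) (hcnt₂ : WalkWeightsSummable geo bg E₂ W₂)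
    (hdom : ∀ (i : I) (U : (bg i).Cfg), (E₁ i).Converges U ∧ (E₂ i).Converges U →
      DominatedBySums (pairExpansion (E₁ i) (E₂ i) (D₁ i).Touches (locData₂ (D₁ i) (X₂ i) (Meets₂ i)).Touches)
        (pairTermK (E₁ i) (E₂ i) _ _ (termK₁ i) (termK₂ i)) (Kdiff i)
        (pairWalkSets (W₁ i) (W₂ i) (D₁ i).Touches (locData₂ (D₁ i) (X₂ i) (Meets₂ i)).Touches) U) :
    Thm314LocalPrinted c35 geo bg Kdiff OmK dOmega :=
  (thm314_pair_of_pair_walks D₁ X₂ Meets₂ L₁ L₂ r₀ hr S hdΩ h₁ h₂ W₁ W₂ hW₁ hW₂ hcnt₁ hcnt₂ hdom).2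

open Classical in
/-- ★ **ROW 22** (`B9.Thm314Printed`) over the pair, walk sets per sequence. [cite: Balaban1985BackgroundPropagators, Thm 3.14 (3.154) pp.426–427] -/
theorem thm314Printed_of_pair_walks (D₁ : ∀ i, LocData (geo i) (bg i) (E₁ i))
    (X₂ : ∀ i, (E₂ i).Walk → ℕ → (geo i).Site → Prop) (Meets₂ : ∀ i, (E₂ i).Walk → ℕ → Prop)
    (L₁ : ∀ i, (D₁ i).Laws (dOmega i)) (L₂ : ∀ i, (locData₂ (D₁ i) (X₂ i) (Meets₂ i)).Laws (dOmega i)) (r₀ : ℝ)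
    (hr : ∀ i, (D₁ i).diam ≤ r₀) (S : ∀ i, ModelSignsOn (geo i) (Ps i)) (hdΩ : ∀ (i : I) (y y' : (geo i).Site), 0 ≤ dOmega i y y')
    (h₁ : Thm310AllNormsPrinted c35 geo bg E₁ termK₁) (h₂ : Thm310AllNormsPrinted c35 geo bg E₂ termK₂)
    (W₁ : ∀ i, ℕ → (geo i).Site → (geo i).Site → Finset (E₁ i).Walk)
    (W₂ : ∀ i, ℕ → (geo i).Site → (geo i).Site → Finset (E₂ i).Walk)
    (hW₁ : ∀ i, WalkSetsSpec (E₁ i) (W₁ i)) (hW₂ : ∀ i, WalkSetsSpec (E₂ i) (W₂ i))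
    (hcnt₁ : WalkWeightsSummable geo bg E₁ W₁) (hcnt₂ : WalkWeightsSummable geo bg E₂ W₂)
    (hdom : ∀ (i : I) (U : (bg i).Cfg), (E₁ i).Converges U ∧ (E₂ i).Converges U →
      DominatedBySums (pairExpansion (E₁ i) (E₂ i) (D₁ i).Touches (locData₂ (D₁ i) (X₂ i) (Meets₂ i)).Touches)
        (pairTermK (E₁ i) (E₂ i) _ _ (termK₁ i) (termK₂ i)) (Kdiff i)
        (pairWalkSets (W₁ i) (W₂ i) (D₁ i).Touches (locData₂ (D₁ i) (X₂ i) (Meets₂ i)).Touches) U) :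
    Thm314Printed c35 geo bg Kdiff dOmega :=
  (thm314_pair_of_pair_walks (OmK := fun _ _ => True) D₁ X₂ Meets₂ L₁ L₂ r₀ hr S hdΩ h₁ h₂ W₁ W₂ hW₁ hW₂ hcnt₁ hcnt₂ hdom).1

end Rows

end Literature.MathematicalPhysics.QuantumFieldTheory.Balaban1983to89.B9Thm314WholePairWalks
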